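import Summits.Ventures.PercRepro.RankLevelSetExplicitLin2KeyL
import Summits.Ventures.PercRepro.RankLevelSetExplicitLin2IndepRowFifteenA

/-!
# PercRepro — THE LEVEL-15 THEOREM-M ROW OF C-025: THE KEY AT `p = 36 940` (p4, S4 feed)

`proofs/P4-gen18.md`. With THEOREM M's staircase multiplicity the assembled inequality `(P_d)` holds, exactly evaluated, at EVERY
core corank `16 ≤ d ≤ 32783` from `p = 5 784` (it fails at `p = 5 783`, corank `16`; the quartic floor is `74 775`, the
saturated one `383 509`). The row is taken at `p = 36 940` = the Chernoff tail `⌈(9(15 + 2^15) + 17·15 + 216)/8⌉` of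
RankLevelSetExplicitLin2LevelTail, which now binds: the key `KeyL 15 36940 d` (RankLevelSetExplicitLin2KeyL) is checked by the kernel at the
32 768 coranks (`decide`, 8 chunks of 4 096). The level step and the unconditional chain are
RankLevelSetExplicitLin2IndepFloor (`c025_fifteen_indep_step`, `c025_fifteen_indep_from_36940`). Axioms: standard.
-/

namespace PercRepro

namespace ThmN

namespace Explicit

/-- The THEOREM-M key row at `(q, p) = (15, 36 940)`, chunk 5 of 8: coranks `16400 … 20495`, by the kernel. -/
theorem key_fifteen_indep_row_5 : ∀ t < 4096, KeyL 15 36940 (16 + (16384 + t)) := by decide +kernel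

/-- The THEOREM-M key row at `(q, p) = (15, 36 940)`, chunk 6 of 8: coranks `20496 … 24591`, by the kernel. -/
theorem key_fifteen_indep_row_6 : ∀ t < 4096, KeyL 15 36940 (16 + (20480 + t)) := by decide +kernel

/-- The THEOREM-M key row at `(q, p) = (15, 36 940)`, chunk 7 of 8: coranks `24592 … 28687`, by the kernel. -/
theorem key_fifteen_indep_row_7 : ∀ t < 4096, KeyL 15 36940 (16 + (24576 + t)) := by decide +kernel

/-- The THEOREM-M key row at `(q, p) = (15, 36 940)`, chunk 8 of 8: coranks `28688 … 32783`, by the kernel. -/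
theorem key_fifteen_indep_row_8 : ∀ t < 4096, KeyL 15 36940 (16 + (28672 + t)) := by decide +kernel

/-- **THE THEOREM-M KEY ROW AT `(q, p) = (15, 36 940)`**: `KeyL 15 36940 d` at every corank `16 ≤ d ≤ 32783` (the 8 chunks). -/
theorem key_fifteen_indep_row : ∀ t < 32768, KeyL 15 36940 (16 + t) :=
  ball_lt_add (fun t => KeyL 15 36940 (16 + t)) 28672 4096
    (ball_lt_add (fun t => KeyL 15 36940 (16 + t)) 24576 4096
    (ball_lt_add (fun t => KeyL 15 36940 (16 + t)) 20480 4096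
    (ball_lt_add (fun t => KeyL 15 36940 (16 + t)) 16384 4096
    (ball_lt_add (fun t => KeyL 15 36940 (16 + t)) 12288 4096
    (ball_lt_add (fun t => KeyL 15 36940 (16 + t)) 8192 4096
    (ball_lt_add (fun t => KeyL 15 36940 (16 + t)) 4096 4096
    (key_fifteen_indep_row_1) key_fifteen_indep_row_2) key_fifteen_indep_row_3) key_fifteen_indep_row_4) key_fifteen_indep_row_5) key_fifteen_indep_row_6) key_fifteen_indep_row_7) key_fifteen_indep_row_8

/-- **THE KEY'S OWN FLOOR IS `5 784`**: the THEOREM-M key FAILS at `p = 5 783`, corank `16`, by the kernel (the row sits at the tail `36 940`). -/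
theorem key_fifteen_indep_sharp : ¬ KeyL 15 5783 16 := by decide +kernel

end Explicit

end ThmN

end PercRepro
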